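import Summits.Ventures.PackingBounds.Conjectures.DiploSimplexPetersenCross

/-!
# `petersenCrossValue` is attained for every `n ≥ 5` and every `s`; hence `petersenCrossValue n s < dipValue n s → ¬ DiploMinimises n s`

Framing: lottery ticket; floor = certified bounds/negative ranges. Venture `PackingBounds` (cell `pub-packcert`, seat `pub-packcert-energy`, gen 26) —
wiring between `Conjectures/DiploSimplexThreshold` (`petersenCrossValue`, `ConjectureBsharp`) and `Conjectures/DiploSimplexPetersenCross` (the configurations `X_n`).

* `exists_petersenCross_value` — for `n = 4 + k` and every real `s`, the configuration `X_n` has Riesz-`s` energy exactly `petersenCrossValue n s`.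
* `not_diploMinimises_of_petersenCross_lt` — for `n ≥ 5`: `petersenCrossValue n s < dipValue n s → ¬ DiploMinimises n s` (all kernel negatives of this cell at
  `(5,4)`, `(6,6)`, `(6,8)`, `(7,8)`, `(8,10)`, `(9,12)`, `(9,14)` are instances of closed-form inequalities).
* `conjectureBsharp_consistent'` — `ConjectureBsharp → ¬ DiploMinimises 7 8 ∧ ¬ DiploMinimises 8 10`.
-/

noncomputable section

open Finset
open scoped RealInnerProductSpace

namespace Summit.Ventures.PackingBounds.Conjectures

/-- For unit vectors: `‖x - y‖^{-s} = √(2 - 2⟪x,y⟫)^{-s}`. [folklore] -/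
private theorem norm_sub_rpow_eq_sqrt {N : ℕ} {x y : EuclideanSpace ℝ (Fin N)} (hx : ‖x‖ = 1) (hy : ‖y‖ = 1) (s : ℝ) :
    ‖x - y‖ ^ (-s) = Real.sqrt (2 - 2 * inner ℝ x y) ^ (-s) := by
  have hsq : ‖x - y‖ ^ 2 = 2 - 2 * inner ℝ x y := by rw [norm_sub_sq_real, hx, hy]; ring
  rw [← hsq, Real.sqrt_sq (norm_nonneg _)]

/-- **`X_{4+k}` attains `petersenCrossValue (4+k) s`** for every real `s`. -/
theorem exists_petersenCross_value (k : ℕ) (s : ℝ) : ∃ C : Finset (EuclideanSpace ℝ (Fin (4 + k))), C.card = 2 * (4 + k) + 2 ∧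
    (∀ z ∈ C, ‖z‖ = 1) ∧ ∑ x ∈ C, ∑ y ∈ C.erase x, ‖x - y‖ ^ (-s) = petersenCrossValue (4 + k) s := by
  obtain ⟨C, hc, h1, hE⟩ := exists_petersenCross k
  refine ⟨C, by rw [hc]; ring, h1, ?_⟩
  have hconv : ∑ x ∈ C, ∑ y ∈ C.erase x, ‖x - y‖ ^ (-s) =
      ∑ x ∈ C, ∑ y ∈ C.erase x, (fun t => Real.sqrt (2 - 2 * t) ^ (-s)) (inner ℝ x y) := by
    refine sum_congr rfl fun x hx => sum_congr rfl fun y hy => ?_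
    exact norm_sub_rpow_eq_sqrt (h1 x hx) (h1 y (mem_of_mem_erase hy)) s
  rw [hconv]
  refine (hE (fun t => Real.sqrt (2 - 2 * t) ^ (-s))).trans ?_
  have h4 : Real.sqrt (2 - 2 * (-1 : ℝ)) = 2 := by
    rw [show (2 - 2 * (-1 : ℝ)) = 2 ^ 2 by norm_num, Real.sqrt_sq (by norm_num)]
  simp only [petersenCrossValue, h4]
  push_cast
  norm_num
  ring

/-- **Closed-form test for non-optimality of the diplo-simplex** (`n ≥ 5`): if the competitor `X_n` is strictly below, `D_n` does not minimise. -/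
theorem not_diploMinimises_of_petersenCross_lt (n : ℕ) (hn : 5 ≤ n) (s : ℝ) (h : petersenCrossValue n s < dipValue n s) :
    ¬ DiploMinimises n s := by
  intro hmin
  obtain ⟨k, rfl⟩ : ∃ k, n = 4 + k := ⟨n - 4, by omega⟩
  obtain ⟨C, hc, h1, hE⟩ := exists_petersenCross_value k s
  have := hmin C hc h1
  rw [hE] at this
  linarith

/-- At `(7, 8)`: `petersenCrossValue 7 8 < dipValue 7 8`. -/
theorem petersenCross_lt_dip_seven_eight : petersenCrossValue 7 8 < dipValue 7 8 := by
  rw [petersenCrossValue_of_eq 7 4 8 (by norm_num), dipValue_of_eq 7 (by norm_num) 4 8 (by norm_num)]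
  norm_num

/-- At `(8, 10)`: `petersenCrossValue 8 10 < dipValue 8 10`. -/
theorem petersenCross_lt_dip_eight_ten : petersenCrossValue 8 10 < dipValue 8 10 := by
  rw [petersenCrossValue_of_eq 8 5 10 (by norm_num), dipValue_of_eq 8 (by norm_num) 5 10 (by norm_num)]
  norm_num

/-- **Consistency of B″ at `n = 7, 8`**: `ConjectureBsharp → ¬ DiploMinimises 7 8 ∧ ¬ DiploMinimises 8 10` (both right-hand sides are kernel theorems:
`not_diploMinimises_seven_eight`, `not_diploMinimises_eight_ten`). -/
theorem conjectureBsharp_consistent' (h : ConjectureBsharp) : ¬ DiploMinimises 7 8 ∧ ¬ DiploMinimises 8 10 := by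
  refine ⟨fun h78 => ?_, fun h810 => ?_⟩
  · have := (h 7 (by norm_num) (by norm_num) 8 (by norm_num)).1 h78 8 (by norm_num) le_rfl
    linarith [petersenCross_lt_dip_seven_eight]
  · have := (h 8 (by norm_num) (by norm_num) 10 (by norm_num)).1 h810 10 (by norm_num) le_rfl
    linarith [petersenCross_lt_dip_eight_ten]

end Summit.Ventures.PackingBounds.Conjectures

end
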